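import Summits.QuantumFields.YangMills.Theorems.SwapVirialDeficitBlowUpGnomonicFibreDefs
import Summits.QuantumFields.YangMills.Theorems.SwapVirialDeficitBlowUpGnomonicDeficitDefs
import Summits.QuantumFields.YangMills.Theorems.SwapVirialDeficitBlowUpGnomonicRingChartReal
import HarnessLib

/-!
# Route `SwapVirialDeficit` (YangMills): LETTERS OF THE (S)-ROAD ASSEMBLY — the per-sector Morse–Bott bulk∕rest data in the joint gnomonic chart
# (definitions only; cell ym-idea-1, LEAD g97 allocation ➍ ∕ referee memo4, assembler fcl-p3 g47)

The two even sectors `z₀ = 000`, `z₁ = 001` of the σ-glued ring must each supply the polynomial bulk∕rest data of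
✓`SwapRing.swapGluedStiffness_of_bulk_rest_rate` ≡ ✓`SwapRing.swapMeanActionGap_of_bulk_rest_rate` (⟨24197⟩ `SwapGluedStiffness`, ⟨24194⟩ `SwapMeanActionGap`).
In the joint gnomonic chart (✓`integral_exp_swapDeficit_eq_gnomonic`: `Ẑ_z(L,b) = K_L·∫_cone Σ_ε ∫_{GnoCoord L} e^{−bF̂_{a,ε}}·ρ`; hub `a` ↦ the seam, letters `x ↦ C₀`,
`y ↦ C₂`, `z` = σ-slaving letter, followers) and w2 g59's Euclidean fibre (✓`gnoBase`, ✓`gnoFibreEmb`, ✓`gnoFibreEquiv`, `V_L = GnoFibre L`, `dim V_L = 18L⁴ − 2 = 2α`),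
this file fixes the LETTERS the stub owners prove against (LEAD ruling 2026-08-31 17:34Z ∕ 17:54Z: the main constant is the FULL bottom integral, `b`-independent;
one `b`-dependent cut `ψ₀(b)`, `V₀(b)` chosen only in the assembly):

* sectors `z₀`, `z₁`; the chart constant `KL L = coneConst³∕64·(2π²)^{−|Fol L|}`; `alpha L = dim V_L ∕ 2` (`= 9L⁴ − 1`, ✓`finrank_gnoFibre_real_div_two`);
* `GoodSign ε` (slaving letter and all followers on the `+` hemisphere — the flat bottom of sector 000 lives there, w3 g66 ✓`gnoDeficit_base_eq_zero`);
* hub stiffnesses `hubS1 a = sin²2ψ`, `hubS2 a = sin²ψ` (the letter weights of ✓`fibre_raySecond_coercive_gnomonic_explicit`), the bulk hubs `HubBulk ψ₀`, the gnomonic box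
  `GnoBox V₀` ∕ `BaseBox V₀` (`|x₀|, |y₀| ≤ V₀`);
* the fibre quadratic form `fibQ a ε p y = (d²∕ds²) F̂(gnoBase p + s·gnoFibreEmb y)|₀` (`= ⟪A(gnoBase p) y, y⟫` for w2 g59's ✓`exists_gnoFibreHessian`), the MORSE–BOTT DENSITY
  `mbDensity a ε p = ρ(gnoBase p)·(2π)^{−α}·∫_{V_L} e^{−½ fibQ}` (`= ρ(η₀)∕√det A`), the main constant `mbConst L = K_L·Σ_{good ε}∫_cone∫_{ℝ²} mbDensity` (FULL bottom)
  and its bulk part `mbBulk L ψ₀ V₀`;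
* the integrals: `boxIntegral a ε b V₀ = ∫_{GnoBox V₀} e^{−bF̂_{a,ε}}ρ`, `bulkIntegral L b ψ₀ V₀ = K_L·Σ_{good ε}∫_{HubBulk ψ₀} boxIntegral`,
  `goodIntegral L b` (good signs, all hubs, whole fibre), `chartIntegral L b` (everything; `= Ẑ₀(L,b)`);
* §4 (E1, appended): `hubIntegral a ε b` (whole fibre at a hub), `TipHub ψ₀`, `EndHub ψ₀` (`ℍ = Tip ⊔ End ⊔ Bulk`), `bulkHubIntegral L b ψ₀`, `mbHubBulk L ψ₀`
  (the bulk-hub parts with NO gnomonic cut, for w2 g59's rescaled-fibre bulk law `bulk_fibred_plane`);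
* §5 (➎, appended): `hubActionIntegral a ε b = ∫ F̂e^{−bF̂}ρ` and `stiffKappa L c = 9L⁴ − 3∕2 + c` (per-region stiffness inequalities, LEAD g98 18:47Z);
* §6 (➎, appended): `fibreMeasure L = ρ(η)dη`, `chartMeasure L = cone ⊗ ρ(η)dη` on `ℍ × GnoCoord L` (regions = measurable subsets, per sign pattern; LEAD g98 18:55Z);
* §7 (➎, appended): `BTube L τ` — the B-tubes (end hubs `|re a| < τ‖a‖` × x-letters with transverse modulus `≥ τ` × whole remaining fibre; w3 g66 ∕ LEAD g98 19:34Z).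
* §8 (➎, appended): `uJ` — the unit quaternion `j`, the left translation of the `y`-letter of the sector-001 chart (`C₂ = Q(j·ŷ)`, LEAD g98 19:28Z; ✓`trGnomonicPoint uJ`).
* §9 (➎, appended): `sectorChar z` — the SECTOR CHARACTER `χ_z(x) = centreElem(⊕ₖ (zₖ ∧ xₖ ≠ 0))`, the central seam values with which the chart deficit of sector `z`
  has its flat valley at finite gnomonic distance (the `χ` of ✓`chartDeficit_twisted_eq_zero_iff`); `sectorChar z₀ ≡ 1`, `sectorChar z₁ x = centreElem (x₂ ≠ 0)`.
* §10 (➎, appended): `BTubeCap L τ X₁` — the B-tubes with an AXIAL CAP on the rescaled `x₀`-letter, `|η_x0| ≤ X₁·√(1 + η_x1² + η_x2²)` (LEAD g99 ruling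
  2026-08-31 20:48Z: the far floor is false on the uncapped tube — `x₀ → ∞` at `|u| = τ` approaches stratum A — and true on the capped one).

HONEST LABEL: definitions only (reviewed Defs file of the route's posited objects); nothing about ⟨24197⟩ ∕ ⟨24194⟩ (OPEN) is proved; ⟨24196⟩ proved elsewhere;
item of record ⟨24085⟩ SubOctaveBounded aside ∕ untouched; the Yang–Mills mass gap is NOT proved; no summit is proved by a line.  No instance, no notation,
standard axioms.  Seat ym-line-fcl-p3 g47 (cell ym-idea-1, free hands), `--supports stmt-QuantumFields-24197`.  References: [cite: tHooft1979]; [cite: Luscher1983, §2]; [folklore].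
-/

set_option autoImplicit false
set_option synthInstance.maxSize 1024

noncomputable section

open MeasureTheory Quaternion Set
open scoped Quaternion BigOperators ENNReal
open Literature.MathematicalPhysics.QuantumLattice
open Literature.MathematicalPhysics.QuantumFieldTheory hiding SU2
open Summit.QuantumFields.YangMills.Theorems.SwapTwistDeficit.ToronLog

attribute [local instance] Literature.Analysis.FluidPDE.Tao2016.quatMeasurableSpace
  Literature.Analysis.FluidPDE.Tao2016.quatBorelSpace
  Literature.MathematicalPhysics.QuantumLattice.secondCountableTopology_su2

namespace Summit.QuantumFields.YangMills.Theorems.SwapVirialDeficit.SectorLaplace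

open Summit.QuantumFields.YangMills.Theorems.FemtoTransferGap
open Summit.QuantumFields.YangMills.Theorems.FemtoTransferGap.TT
open Summit.QuantumFields.YangMills.Theorems.VirialFluxGap.RingDeficit
open Summit.QuantumFields.YangMills.Theorems.SwapVirialDeficit.SwapRing
open Summit.QuantumFields.YangMills.Theorems.SwapVirialDeficit.BlowUpRing

variable {L : ℕ} [NeZero L]

/-! ## §1 Sectors, constants, signs, regions -/

/-- The even seam sector `z = 000` of the σ-glued ring. [cite: tHooft1979] -/
abbrev z₀ : Fin 3 → Bool := fun _ => false

/-- The even seam sector `z = 001` (twist across the plane `k = 2`). [cite: tHooft1979] -/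
abbrev z₁ : Fin 3 → Bool := fun k => decide (k = 2)

/-- The constant of the joint gnomonic chart, `K_L = coneConst³∕64 · (2π²)^{−|Fol L|}` (✓`integral_ringMeasure_eq_gnomonic`). [folklore] -/
def KL (L : ℕ) [NeZero L] : ℝ := coneConst ^ 3 / 64 * (1 / (2 * Real.pi ^ 2)) ^ Fintype.card (Fol L)

/-- Half the fibre dimension, `α = dim V_L ∕ 2` (`= 9L⁴ − 1`, ✓`finrank_gnoFibre_real_div_two`): the Morse–Bott exponent `e₀` of sector 000. [folklore] -/
def alpha (L : ℕ) [NeZero L] : ℝ := (Module.finrank ℝ (GnoFibre L) : ℝ) / 2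

/-- GOOD hemisphere signs of sector 000: the σ-slaving letter `z` and every follower on the `+` hemisphere (the flat bottom lives there:
w3 g66 ✓`gnoDeficit_base_eq_zero`; the other patterns are a far region, ✓`gnoDeficit_one_ge_of_follower_sign_false`). [folklore] -/
abbrev GoodSign (ε : GnoSign L) : Prop := ε.2.1 = true ∧ ε.2.2 = fun _ => true

/-- `sin²(2ψ)` of the hub `a` — the transverse stiffness weight of the letter `x` (✓`fibre_raySecond_coercive_gnomonic_explicit`). [folklore] -/
def hubS1 (a : ℍ) : ℝ := (2 * (‖a‖⁻¹ * a.re) * (‖a‖⁻¹ * ‖a.im‖)) ^ 2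

/-- `sin²ψ` of the hub `a` — the transverse stiffness weight of the letter `y`. [folklore] -/
def hubS2 (a : ℍ) : ℝ := (‖a‖⁻¹ * ‖a.im‖) ^ 2

/-- THE BULK HUBS at cut `ψ₀`: `a ≠ 0` with both stiffness weights `≥ ψ₀`; the complement is the TIP `ψ → 0` and the END `ψ → π∕2`. [folklore] -/
def HubBulk (ψ₀ : ℝ) : Set ℍ := {a | a ≠ 0 ∧ ψ₀ ≤ hubS1 a ∧ ψ₀ ≤ hubS2 a}

/-- THE GNOMONIC BOX `|x₀|, |y₀| ≤ V₀` on the axial coordinates of the letters `x, y` (complement: the gnomonic ends). [folklore] -/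
def GnoBox (V₀ : ℝ) : Set (GnoCoord L) := {η | |η.1.1 0| ≤ V₀ ∧ |η.1.2 0| ≤ V₀}

/-- The same box read on the base `ℝ²` of ✓`gnoFibreEquiv`. [folklore] -/
def BaseBox (V₀ : ℝ) : Set (ℝ × ℝ) := {p | |p.1| ≤ V₀ ∧ |p.2| ≤ V₀}

/-! ## §2 The Morse–Bott density and the main constant -/

/-- THE FIBRE QUADRATIC FORM at the base point over `p = (x₀, y₀)`: `Q_{a,ε,p}(y) = (d²∕ds²) F̂_{a,ε}(gnoBase p + s·gnoFibreEmb y)|_{s=0}`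
(`= ⟪A(gnoBase p) y, y⟫` for the fibre Hessian operators of w2 g59 ✓`exists_gnoFibreHessian`). [cite: Luscher1983, §2] -/
def fibQ (a : ℍ) (ε : GnoSign L) (p : ℝ × ℝ) (y : GnoFibre L) : ℝ :=
  iteratedDeriv 2 (fun s : ℝ => gnoDeficit z₀ (fun _ => 1) a ε (gnoBase p.1 p.2 + s • gnoFibreEmb y)) 0

/-- THE MORSE–BOTT DENSITY of sector 000: `𝔪(a,ε,p) = ρ(gnoBase p)·(2π)^{−α}·∫_{V_L} e^{−½Q_{a,ε,p}(y)} dy` (`= ρ(η₀)∕√det A(a,p)` where `Q` is coercive;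
Bochner value, junk `0` only on the null hubs `re a = 0`, `im a = 0`). [folklore] -/
def mbDensity (a : ℍ) (ε : GnoSign L) (p : ℝ × ℝ) : ℝ :=
  gnoDensity (gnoBase (L := L) p.1 p.2) * ((2 * Real.pi) ^ alpha L)⁻¹ * ∫ y : GnoFibre L, Real.exp (-(fibQ a ε p y / 2))

/-- THE MAIN CONSTANT `𝔐₀(L) = K_L·Σ_{good ε}∫_cone∫_{ℝ²} 𝔪` — the FULL flat bottom, tip and ends included, `b`-independent (LEAD ruling 17:34Z (1)). [folklore] -/
def mbConst (L : ℕ) [NeZero L] : ℝ :=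
  KL L * ∑ ε ∈ (Finset.univ.filter fun ε : GnoSign L => GoodSign ε), ∫ a, (∫ p : ℝ × ℝ, mbDensity a ε p) ∂coneMeasure

/-- The main constant's BULK part `K_L·Σ_{good ε}∫_{HubBulk ψ₀}∫_{BaseBox V₀} 𝔪`. [folklore] -/
def mbBulk (L : ℕ) [NeZero L] (ψ₀ V₀ : ℝ) : ℝ :=
  KL L * ∑ ε ∈ (Finset.univ.filter fun ε : GnoSign L => GoodSign ε), ∫ a in HubBulk ψ₀, (∫ p in BaseBox V₀, mbDensity a ε p) ∂coneMeasure

/-! ## §3 The integrals of the split -/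

/-- THE BOX INTEGRAL at hub `a`, signs `ε`: `∫_{GnoBox V₀} e^{−bF̂_{a,ε}(η)}·ρ(η) dη` (whole fibre over the boxed base). [folklore] -/
def boxIntegral (a : ℍ) (ε : GnoSign L) (b V₀ : ℝ) : ℝ :=
  ∫ η : GnoCoord L, (GnoBox V₀).indicator (fun η => Real.exp (-(b * gnoDeficit z₀ (fun _ => 1) a ε η)) * gnoDensity η) η

/-- THE BULK PART `Ib(L,b; ψ₀,V₀) = K_L·Σ_{good ε}∫_{HubBulk ψ₀} boxIntegral ∂cone`. [folklore] -/
def bulkIntegral (L : ℕ) [NeZero L] (b ψ₀ V₀ : ℝ) : ℝ :=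
  KL L * ∑ ε ∈ (Finset.univ.filter fun ε : GnoSign L => GoodSign ε), ∫ a in HubBulk ψ₀, boxIntegral a ε b V₀ ∂coneMeasure

/-- THE GOOD-SIGN PART `K_L·Σ_{good ε}∫_cone∫ e^{−bF̂}ρ` (all hubs, whole fibre). [folklore] -/
def goodIntegral (L : ℕ) [NeZero L] (b : ℝ) : ℝ :=
  KL L * ∑ ε ∈ (Finset.univ.filter fun ε : GnoSign L => GoodSign ε),
    ∫ a, (∫ η : GnoCoord L, Real.exp (-(b * gnoDeficit z₀ (fun _ => 1) a ε η)) * gnoDensity η) ∂coneMeasure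

/-- THE WHOLE CHART INTEGRAL `K_L·∫_cone Σ_ε ∫ e^{−bF̂}ρ` (`= Ẑ₀(L,b)` for `b ≥ 0`, ✓`integral_exp_swapDeficit_eq_gnomonic`). [folklore] -/
def chartIntegral (L : ℕ) [NeZero L] (b : ℝ) : ℝ :=
  KL L * ∫ a, (∑ ε : GnoSign L, ∫ η : GnoCoord L, Real.exp (-(b * gnoDeficit z₀ (fun _ => 1) a ε η)) * gnoDensity η) ∂coneMeasure

/-! ## §4 The E1 letters (LEAD g98 cycle, 2026-08-31 ≥ 18:24Z; w2 g59's rescaled fibre ⟹ no gnomonic cut `V₀`): tip ∕ end hubs, the hub integral,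
and the bulk-hub parts WITHOUT the base box -/

/-- THE GOOD-SIGN FIBRE INTEGRAL AT A HUB: `I(a,ε;b) = ∫_{GnoCoord L} e^{−bF̂_{a,ε}}·ρ` (whole fibre, whole base; the summand of `goodIntegral`). [folklore] -/
def hubIntegral (a : ℍ) (ε : GnoSign L) (b : ℝ) : ℝ :=
  ∫ η : GnoCoord L, Real.exp (-(b * gnoDeficit z₀ (fun _ => 1) a ε η)) * gnoDensity η

/-- THE TIP HUBS at cut `ψ₀`: `sin²ψ < ψ₀` (seam `c` nearly central; contains `a = 0` and the apex of the flat bottom). [folklore] -/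
def TipHub (ψ₀ : ℝ) : Set ℍ := {a | hubS2 a < ψ₀}

/-- THE END HUBS at cut `ψ₀`: `sin²2ψ < ψ₀ ≤ sin²ψ` (seam nearly pure imaginary, `ψ → π∕2`; contains the lower flat stratum B, LEAD g97 memo4 §2).
`ℍ = TipHub ψ₀ ⊔ EndHub ψ₀ ⊔ HubBulk ψ₀` for `ψ₀ > 0`. [folklore] -/
def EndHub (ψ₀ : ℝ) : Set ℍ := {a | hubS1 a < ψ₀ ∧ ψ₀ ≤ hubS2 a}

/-- THE BULK-HUB INTEGRAL WITHOUT GNOMONIC CUT (`V₀ = ∞`): `K_L·Σ_{good ε}∫_{HubBulk ψ₀} I(a,ε;b) ∂cone`. [folklore] -/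
def bulkHubIntegral (L : ℕ) [NeZero L] (b ψ₀ : ℝ) : ℝ :=
  KL L * ∑ ε ∈ (Finset.univ.filter fun ε : GnoSign L => GoodSign ε), ∫ a in HubBulk ψ₀, hubIntegral a ε b ∂coneMeasure

/-- ITS MORSE–BOTT MAIN PART `K_L·Σ_{good ε}∫_{HubBulk ψ₀}∫_{ℝ²} 𝔪` (the main constant restricted to the bulk hubs, whole base). [folklore] -/
def mbHubBulk (L : ℕ) [NeZero L] (ψ₀ : ℝ) : ℝ :=
  KL L * ∑ ε ∈ (Finset.univ.filter fun ε : GnoSign L => GoodSign ε), ∫ a in HubBulk ψ₀, (∫ p : ℝ × ℝ, mbDensity a ε p) ∂coneMeasure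

/-! ## §5 The ➎ letters (LEAD g98 ruling 2026-08-31 18:47Z «localize the two-sided law»: per-REGION stiffness inequalities
`κ·∫_R e^{−bF̂} ≤ b·∫_R F̂e^{−bF̂}`, additive in the measure): the hub ACTION integral and the stiffness constant -/

/-- THE GOOD-SIGN FIBRE ACTION INTEGRAL AT A HUB: `E(a,ε;b) = ∫_{GnoCoord L} F̂_{a,ε}·e^{−bF̂_{a,ε}}·ρ` (the summand of `∫ F^S e^{−bF^S} dμ_L` in the chart,
✓`integral_swapDeficit_exp_eq_gnomonic`). [folklore] -/
def hubActionIntegral (a : ℍ) (ε : GnoSign L) (b : ℝ) : ℝ :=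
  ∫ η : GnoCoord L, gnoDeficit z₀ (fun _ => 1) a ε η * Real.exp (-(b * gnoDeficit z₀ (fun _ => 1) a ε η)) * gnoDensity η

/-- THE WINDOW STIFFNESS CONSTANT `κ_L(c) = 9L⁴ − 3∕2 + c` of ✓`swapGluedStiffness_of_twoSectorStiffness` (`(TS)_z : κ·∫e^{−βF_z} ≤ β·∫F_z e^{−βF_z}`). [folklore] -/
def stiffKappa (L : ℕ) (c : ℝ) : ℝ := 9 * (L : ℝ) ^ 4 - 3 / 2 + c

/-! ## §6 The ➎ chart measure (LEAD g98 2026-08-31 18:55Z): regions are measurable subsets of `ℍ × GnoCoord L`, one sign pattern at a time -/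

/-- THE FIBRE MEASURE `ρ(η)dη` on the gnomonic coordinates (w2 g59's form `volume.withDensity (ofReal ∘ gnoDensity)`; finite: ✓`integrable_gnoDensity`). [folklore] -/
def fibreMeasure (L : ℕ) [NeZero L] : Measure (GnoCoord L) :=
  (volume : Measure (GnoCoord L)).withDensity fun η => ENNReal.ofReal (gnoDensity η)

/-- THE CHART MEASURE OF ONE SIGN PATTERN: `cone ⊗ ρ(η)dη` on `ℍ × GnoCoord L` (finite).  For bounded measurable `g`,
`∫ g(F^S_z) dμ_L = K_L·Σ_ε ∫ g(F̂_{z,a,ε}(η)) d(chartMeasure)` (✓`integral_ringMeasure_eq_gnomonic`); the per-region stiffness inequalities of ➎ live on it. [folklore] -/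
def chartMeasure (L : ℕ) [NeZero L] : Measure (ℍ × GnoCoord L) :=
  coneMeasure.prod (fibreMeasure L)

/-! ## §7 The ➎ B-tubes (LEAD g98 memo6 §4 ∕ memo7; letter spec w3 g66 2026-08-31 19:34Z as refereed by LEAD 19:34Z (1)–(3)) -/

/-- THE B-TUBES OF SECTOR 000 at cut `τ`: END hubs with nearly pure-imaginary seam, `|re a| < τ·‖a‖` (the hub-polar deviation `δ` is a FIBRE direction of the
tube), whose `x`-letter has transverse modulus `|u| = √(x₁² + x₂²) ≥ τ` (stratum B: `C₀ = exp(su′)`, `u′ ⊥ m`; no upper cap on `|u|`, LEAD (2)); the whole fibre in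
`x₀, y, z, η_F` (LEAD (3)).  The conjunct `a ∈ EndHub τ` is redundant for `τ < 1∕4` (`hubS1 < 4τ²`, `hubS2 > 1 − τ²`) and makes
`BTube L τ ⊆ (TipHub τ ∪ EndHub τ) × fibre` hold for every `τ`.  A measurable subset of `ℍ × GnoCoord L`; per good sign pattern it carries its own two-sided
law (exponent `α + 1∕2`; w3 g66's B-point floors, w2 g59's wiring) — stub `stub_B_stiff` of skeleton ➎. [folklore] -/
def BTube (L : ℕ) (τ : ℝ) : Set (ℍ × GnoCoord L) :=
  {x | x.1 ∈ EndHub τ ∧ |x.1.re| < τ * ‖x.1‖ ∧ τ ≤ Real.sqrt ((x.2.1.1 1) ^ 2 + (x.2.1.1 2) ^ 2)}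

/-! ## §8 The translation unit of the sector-001 chart (LEAD g98 2026-08-31 19:28Z: `C₂ = j·Q(gnoLetter ε_y y′)`) -/

/-- THE UNIT QUATERNION `j`: the left translation of the `y`-letter in the sector-001 chart ✓`trGnomonicPoint uJ a ε η` ∕ ✓`trGnoDeficit uJ z₁`
(the flat set of sector 001 has `C₂` on the equator, at the gnomonic infinity of the untranslated `y`-chart). [folklore] -/
def uJ : ℍ := ⟨0, 0, 1, 0⟩

/-- The components of `uJ`. [folklore] -/
theorem uJ_re : uJ.re = 0 := rfl

/-- The components of `uJ`. [folklore] -/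
theorem uJ_imI : uJ.imI = 0 := rfl

/-- The components of `uJ`. [folklore] -/
theorem uJ_imJ : uJ.imJ = 1 := rfl

/-- The components of `uJ`. [folklore] -/
theorem uJ_imK : uJ.imK = 0 := rfl

/-- `|uJ|² = 1`. [folklore] -/
theorem normSq_uJ : Quaternion.normSq uJ = 1 := by
  simp [uJ, Quaternion.normSq_def']

/-- ★ `‖uJ‖ = 1` — the hypothesis of ✓`lintegral_ringMeasure_eq_trGnomonic` ∕ ✓`integral_ringMeasure_eq_trGnomonic`. [folklore] -/
theorem norm_uJ : ‖uJ‖ = 1 := by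
  have h : ‖uJ‖ * ‖uJ‖ = 1 := by rw [← Quaternion.normSq_eq_norm_mul_self, normSq_uJ]
  have h0 : 0 ≤ ‖uJ‖ := norm_nonneg _
  nlinarith [h, h0]

/-- `uJ ≠ 0`. [folklore] -/
theorem uJ_ne_zero : uJ ≠ 0 := fun h => by
  have h1 := norm_uJ
  rw [h, norm_zero] at h1
  exact zero_ne_one h1

/-- `j² = −1`. [folklore] -/
theorem uJ_mul_uJ : uJ * uJ = -1 := by
  ext <;> simp [uJ]

/-! ## §9 The sector character: the seam twist of sector `z` read in the chart -/

/-- **THE SECTOR CHARACTER** `χ_z(x) = centreElem((z₀ ∧ x₀ ≠ 0) ⊕ (z₁ ∧ x₁ ≠ 0) ⊕ (z₂ ∧ x₂ ≠ 0))`: the CENTRAL seam values with which the chart deficit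
`chartDeficit L z χ_z` of sector `z` (✓`seamField`: `g x = χ(x)·c·V_x`) has its flat valley `B_z × {1}` at FINITE gnomonic distance — literally the `χ` of
✓`chartDeficit_twisted_eq_zero_iff`.  With `χ ≡ 1` instead, the twist of a sector `z ≠ 000` would sit on the seam followers (`V_x = −1`), i.e. at the followers'
gnomonic infinity; so the sector-001 chart is `trGnoDeficit uJ z₁ (sectorChar z₁)`.  `sectorChar z₀ ≡ 1` recovers the principal chart. [cite: tHooft1979] -/
def sectorChar (z : Fin 3 → Bool) : Site 3 L → SU2 :=
  fun x => centreElem (Bool.xor (z 0 && decide (x 0 ≠ 0)) (Bool.xor (z 1 && decide (x 1 ≠ 0)) (z 2 && decide (x 2 ≠ 0))))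

omit [NeZero L] in
/-- Unfolding `sectorChar`. [folklore] -/
theorem sectorChar_apply (z : Fin 3 → Bool) (x : Site 3 L) :
    sectorChar z x = centreElem (Bool.xor (z 0 && decide (x 0 ≠ 0)) (Bool.xor (z 1 && decide (x 1 ≠ 0)) (z 2 && decide (x 2 ≠ 0)))) := rfl

omit [NeZero L] in
/-- `sectorChar z` is the literal `χ` of ✓`chartDeficit_twisted_eq_zero_iff`. [folklore] -/
theorem sectorChar_eq (z : Fin 3 → Bool) :
    sectorChar (L := L) z = fun x => centreElem (Bool.xor (z 0 && decide (x 0 ≠ 0)) (Bool.xor (z 1 && decide (x 1 ≠ 0)) (z 2 && decide (x 2 ≠ 0)))) := rfl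

omit [NeZero L] in
/-- ★ The sector character is CENTRAL: `k·χ_z(x) = χ_z(x)·k` — the hypothesis `hχ` of ✓`lintegral_ringMeasure_eq_gnomonic` ∕ ✓`integral_ringMeasure_eq_trGnomonic`.
[folklore] -/
theorem sectorChar_central (z : Fin 3 → Bool) : ∀ (x : Site 3 L) (k : SU2), k * sectorChar z x = sectorChar z x * k :=
  fun _ k => (Subgroup.mem_center_iff.1 (centreElem_mem_center _)) k

omit [NeZero L] in
/-- The principal sector: `χ_{000} ≡ 1`. [folklore] -/
theorem sectorChar_z₀ : sectorChar (L := L) z₀ = fun _ => 1 := by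
  funext x; simp [sectorChar, z₀, centreElem]

omit [NeZero L] in
/-- Sector `001`: `χ_{001}(x) = centreElem(x₂ ≠ 0)` (the twist through the plane `x₂ = 0`). [folklore] -/
theorem sectorChar_z₁ (x : Site 3 L) : sectorChar z₁ x = centreElem (decide (x 2 ≠ 0)) := by
  simp [sectorChar, z₁]

/-! ## §10 The capped B-tubes (LEAD g99 ruling 2026-08-31 20:48Z: an axial cap on the rescaled `x₀`-letter) -/

/-- THE CAPPED B-TUBES `BTubeCap L τ X₁ := BTube L τ ∩ {|η_x0| ≤ X₁·√(1 + η_x1² + η_x2²)}`: the B-tube with the RESCALED axial letter `X = x₀∕√(1+|u|²)` of the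
`x`-letter capped at `X₁` (an `X`-window, the same kind of object as the `δ`-window of w2's slab-cylinders).  On the uncapped tube the far floor is FALSE
(`x₀ → ∞` at fixed `|u| ≥ τ` is the approach to stratum A ∩ End, LEAD's counterexample against ✓`chartDeficit_le_of_box`); on `BTubeCap` the angle between `C₀`'s
axis and the hub is bounded below and the far floor holds.  The complement inside `EndHub × fibre` joins the END CORE.  `X₁ = 1` is the skeleton's choice. [folklore] -/
def BTubeCap (L : ℕ) (τ X₁ : ℝ) : Set (ℍ × GnoCoord L) :=
  BTube L τ ∩ {x | |x.2.1.1 0| ≤ X₁ * Real.sqrt (1 + (x.2.1.1 1) ^ 2 + (x.2.1.1 2) ^ 2)}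

/-- Unfolding `BTubeCap`. [folklore] -/
theorem BTubeCap_def (L : ℕ) (τ X₁ : ℝ) :
    BTubeCap L τ X₁ = BTube L τ ∩ {x | |x.2.1.1 0| ≤ X₁ * Real.sqrt (1 + (x.2.1.1 1) ^ 2 + (x.2.1.1 2) ^ 2)} := rfl

/-- The capped tube lies in the tube. [folklore] -/
theorem BTubeCap_subset_BTube (L : ℕ) (τ X₁ : ℝ) : BTubeCap L τ X₁ ⊆ BTube L τ := Set.inter_subset_left

/-- Membership in the capped tube. [folklore] -/
theorem mem_BTubeCap_iff (L : ℕ) (τ X₁ : ℝ) (x : ℍ × GnoCoord L) :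
    x ∈ BTubeCap L τ X₁ ↔ x ∈ BTube L τ ∧ |x.2.1.1 0| ≤ X₁ * Real.sqrt (1 + (x.2.1.1 1) ^ 2 + (x.2.1.1 2) ^ 2) := Iff.rfl

end Summit.QuantumFields.YangMills.Theorems.SwapVirialDeficit.SectorLaplace

end
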